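import Literature.MathematicalPhysics.QuantumFieldTheory.BalabanImbrieJaffe1984to88.BIJ88RT51GeneralStep

/-!
# `BalabanImbrieJaffe1984to88.BIJ88RT51NoChange` — T. Bałaban, J. Imbrie, A. Jaffe, *Effective action and cluster properties of the
abelian Higgs model*, Commun. Math. Phys. **114** (1988) 257–315 [BalabanImbrieJaffe1988], Sect. 5.1 p. 278 [PDF 22]: **(5.1.4)** *"no
change is made if we insert the axial gauge conditions"* PROVED FOR THE RENORMALIZATION TRANSFORMATION (5.1.1) OF THE GENERAL STEP —
file 2/2 of seat p34 gen 5 (file 1/2 `BIJ88RT51GeneralStep`: (5.1.1) typed as `IsRT511`/`IsRT511Ax`, (5.1.3), and the pointed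
Faddeev–Popov identity `integral_axialMeasure_eq_of_pointed`).

statement-level skeleton of published theorems with citation tags; proofs where landed; nothing here is a claim about the Yang–Mills mass gap

PDF held: `paper:balaban1988-cmp114-bij-abelian-higgs-effective-action` (journal page = PDF page + 256); pp. 277–278 [PDF 21–22]
read as images (r16's renders `HOME/lit-balaban-r16/renders/cmp114/original-p021-x2.png`, `original-p022-x2.png`).

CITATION HEADER (lean-in-tree rule).  Part of the lit-balaban TYPED SKELETON (HOME `run/shared/lean/pub/lit-balaban/`), PHASE-2
proof seat p34 gen 5 (unit `lit-balaban-p34-g5`; TAKING line HOME/STATUS.md 2026-08-21T06:18Z, free-target protocol G.5-34(d), own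
lineage = the C1/C2 renormalization-transformation line).  Row served: **`C2.Eq5.1.1-5.1.4`** of `HOME/lit-balaban-r16/ROWS-C2-part2.md`
(fold owner r16).

THE PRINTED TEXT (p. 278 [PDF 22], verbatim).  *"Under gauge transformations λ of u, φ, u^{(j)} that vanish on points of T_L^{(k+1)}, we
see that the δ-functions and ρ′_k are invariant. Since u_k also transforms by λ, we have Q(u_k)φ invariant as well. Thus no change is
made if we insert the axial gauge conditions δ_{Ax}(u) = Π_{y∈T₁^{(k)′}} Π_{x∈B(y),x≠y} δ(u(Γ_{y,x})) (5.1.4) into the u-integral above."*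
— "the u-integral above" being that of (5.1.1) p. 277: *"ρ̃^L_{k+1}(v, ψ) = … ≡ Σ_{{X_ω}} ∫𝒟u δ(v/Qu) ∫ Π_{j=0}^{k−1} 𝒟u^{(j)}_{Λ^{(j)c*}_{10}}
∫𝒟φ exp[−½aL⁻²⟨ψ − Q(u_k)φ, ψ − Q(u_k)φ⟩ − E^{(k)}] ρ′_k(u, φ, {X_ω}, {u^{(j)}}). (5.1.1)"*.

WHAT IS PROVED, and how (carriers and typed objects of file 1/2, all of record: levels `k` (unit lattice `T₁^{(k)}`: `u`, `φ`) and `k + 1`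
(block lattice: `v`, `ψ`) of `Balaban1983to89.Setup`, standing range `k + 1 ≤ m + K`; the earlier fields `{u^{(j)}}` =
`BIJ88InductiveForm41.Prev` with `prevMeasure`; r18's `axialMeasure` = `∫𝒟u δ_{Ax}(u)(·)`, `gaussWeight`, `IsRT311`; file 1's `IsPointed`,
`PointedInvariant`, `IsRT511`, `IsRT511Ax`, `uIntegrand`).
* §1 THE `u`-INTEGRAND of a term of (5.1.1), `I(u) = ∫Π𝒟u^{(j)} ∫𝒟φ ∫dψ ρ′({u^{(j)}}, u, φ)·[ψ-Gaussian centred at Q(u_k)φ]·g(Qu, ψ)`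
  (`uIntegrand`), is MEASURABLE when the data are jointly measurable (`measurable_uIntegrand`: Fubini measurability for the `ψ`-, `φ`-
  and `{u^{(j)}}`-integrals in turn) and POINTED-INVARIANT (`pointedInvariant_uIntegrand`) under the printed invariances: `Qu`
  pointed-invariant (*"the δ-functions … are invariant"*), and for every pointed `g` a reparametrization `τ(g)` of the earlier fields
  preserving `Π𝒟u^{(j)}` — their transformation in (4.17); the identity for data ignoring them — with `ρ′(τ(g){u^{(j)}}, u^g, gφ) =
  ρ′({u^{(j)}}, u, φ)` and `Q(u_k)φ` likewise (*"ρ′_k [is] invariant. Since u_k also transforms by λ, we have Q(u_k)φ invariant as well"*);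
  mechanism: substitute `{u^{(j)}} ↦ τ(g){u^{(j)}}` (measure preserving) and `φ ↦ gφ` (`𝒟φ` rotation invariant, r18's
  `BIJ88BlockGauge417.integral_comp_twist`); the block field `ψ` is untouched.  Hence `integral_uIntegrand_axial_eq`:
  `∫𝒟u δ_{Ax}(u) I(u) = ∫𝒟u I(u)` by file 1's `integral_axialMeasure_eq_of_pointed`.
* §2 **(5.1.4) FOR (5.1.1)** `isRT511_iff_isRT511Ax`: under these hypotheses for every term, a function `ρ̃(v, ψ)` satisfies the typed
  (5.1.1) `IsRT511` if and only if it satisfies it with `δ_{Ax}(u)` inserted, `IsRT511Ax` — both define the same densities `ρ̃^L_{k+1}`.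
  Instances discharging every hypothesis: `isRT311_iff_isRT511_single` (one term, data ignoring the earlier fields, `τ = id`: r18's
  (3.11), printed WITH `δ_{Ax}`, versus the `δ_{Ax}`-free transformation) and **`isRT311_printed_iff_free`** for the PRINTED block averages
  `Qu` (2.10), `Q(u)φ` (2.6) of [2] = [BalabanImbrieJaffe1985] on the torus of record (r18's `BIJ85BlockAveragesTorus.qU`/`qCov`), for
  every jointly measurable, jointly pointed-invariant density `ρ₀(u, φ)` — `qU_pointed` (`Q(u^g) = Qu`, from r18's gauge covariance
  `qU_gaugeAct`) and `qCov_pointed` (`Q(u^g)(gφ) = Q(u)φ`, from `qCov_gaugeAct_twist`) for pointed `g`.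
* §3 THE SHAPE OF THE (4.17) TRANSFORMATION OF THE EARLIER FIELDS (p. 277: *"u_b^{(j)} → u_b^{(j)} exp[−ie_kL^jη(∂^{L^jη}Q′*_{k−j}λ)(b)],
  if b ∈ Λ₁^{(j)*c}, u_b^{(j)} → u_b^{(j)}, otherwise"*): bondwise right multiplication by prescribed group elements, `mulRightPrev w`, is a
  measurable equivalence preserving `Π𝒟u^{(j)}` for EVERY prescription `w` (`measurePreserving_mulRightPrev`, right invariance of the
  normalized Haar measures) — hence `isRT511_iff_isRT511Ax_mulRight`: (5.1.4) for (5.1.1) with `τ_t(g) := mulRightPrev (w_t(g))`, only the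
  two invariance identities of `ρ′_t`, `Q_t` left as hypotheses.
* §4 THE NORMALIZATION THROUGH (4.1): `integral_rho_eq_sum` (Fubini: for `𝒟u ⊗ Π𝒟u^{(j)} ⊗ 𝒟φ`-integrable term densities,
  `∫𝒟u𝒟φ Σ_t ∫Π𝒟u^{(j)} ρ′_t = Σ_t ∫𝒟u ∫Π𝒟u^{(j)} ∫𝒟φ ρ′_t` — the order of (4.1) versus the order of (5.1.1)) and
  **`bracket_eq_integral_of_isRT511`**: if the terms of r18's typed inductive form (4.1) represent `[F]` (`BIJ88InductiveForm41.Represents41`,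
  p. 274 *"If we integrate this density over the u, φ variables, we obtain [F]"*) and `ρ̃` is obtained from them by (5.1.1), then
  `[F] = ∫dv dψ ρ̃^L_{k+1}` — the general-step analogue of (3.13), for ANY `Qu`, background kernels and `a > 0` (file 1's
  `integral_eq_of_isRT511`).
NOT DONE HERE (honest scope).  The specific prescription `w` of (4.17) (the factors `exp[−ie_kL^jη(∂Q′*_{k−j}λ)(b)]` on `Λ₁^{(j)*c}`) and the
invariance of the concrete `ρ′_k`, `u_k` of Sects. 4–5 under it are hypotheses here (r18's `BIJ88BlockGauge417.backgroundU_blockGauge` treats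
the background part of (4.2) for block-constant `λ`), discharged only in the history-free instances; no existence statement for `ρ̃`; no
bound.  One definition with body (`mulRightPrev`), theorems otherwise; re-declares nothing; imports file 1/2 (Literature + Mathlib); no
`Prop`-valued fact; standard axioms.
-/

namespace Literature.MathematicalPhysics.QuantumFieldTheory.BalabanImbrieJaffe1984to88.BIJ88RT51NoChange

open Literature.MathematicalPhysics.QuantumFieldTheory.Balaban1983to89
open BIJ88Sect3Statements (U1 toC toC_one cfg bracket)
open BIJ85Sect1Model (HiggsField)
open BIJ85RT33 (twist twist_apply)
open BIJ88RenormTransf311 (axialMeasure gaussWeight IsRT311)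
open BIJ85BlockAveragesTorus (corner qU qCov qU_gaugeAct qCov_gaugeAct_twist)
open BIJ88InductiveForm41 (Prev prevMeasure)
open BIJ88BlockGauge417 (integral_comp_twist)
open BIJ88RT51GeneralStep (IsPointed PointedInvariant integral_axialMeasure_eq_of_pointed IsRT511 IsRT511Ax uIntegrand isRT511_iff
  isRT511Ax_iff isRT511Ax_single_iff_isRT311 integral_eq_of_isRT511)
open T4AxialGaugeFixing (gaugeAct_const_one)
open GaugeField (gaugeAct)
open scoped BigOperators ENNReal
open _root_.MeasureTheory _root_.MeasureTheory.Measure Complex Function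

noncomputable section

variable {P : Params}

/-! ## §1 The `u`-integrand of (5.1.1) is measurable and pointed-invariant -/

section NoChange

variable {k : ℕ}

/-- kernel (plumbing): the block-field Gaussian weight of (3.11)/(5.1.1), read in `ℂ`, is jointly measurable in its centre and in
`ψ` along any measurable parametrization (coordinatewise: a finite sum of squared norms under `exp`). [folklore] -/
private theorem measurable_gaussWeight_comp {α : Type*} [MeasurableSpace α] (a : ℝ) {c ψ : α → HiggsField P (k+1)}
    (hc : Measurable c) (hψ : Measurable ψ) :
    Measurable fun x => (gaussWeight (P := P) (j := k) a (c x) (ψ x) : ℂ) := by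
  unfold gaussWeight
  refine Complex.measurable_ofReal.comp (Real.measurable_exp.comp ?_)
  refine Measurable.sub_const (Measurable.const_mul (Finset.measurable_sum _ fun y _ => ?_) _) _
  exact ((((measurable_pi_apply y).comp hψ).sub ((measurable_pi_apply y).comp hc)).norm.pow_const 2).const_mul _

/-- **The `u`-integrand of (5.1.1) is measurable** (Fubini measurability, applied to the `ψ`-, `φ`- and `{u^{(j)}}`-integrals in turn)
whenever the data are jointly measurable: `Qu` in `u`, `Q(u_k)φ` and `ρ′` in `({u^{(j)}}, u, φ)`, the test function `g`.
[cite: BalabanImbrieJaffe1988, (5.1.1) p.277] -/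
theorem measurable_uIntegrand {Qu : GaugeField P k U1 → GaugeField P (k+1) U1}
    {Qφ : Prev P k → GaugeField P k U1 → HiggsField P k → HiggsField P (k+1)} {a : ℝ}
    {ρ' : Prev P k → GaugeField P k U1 → HiggsField P k → ℂ} {g : GaugeField P (k+1) U1 × HiggsField P (k+1) → ℂ}
    (hQu : Measurable Qu)
    (hQφ : Measurable fun p : Prev P k × (GaugeField P k U1 × HiggsField P k) => Qφ p.1 p.2.1 p.2.2)
    (hρ : Measurable fun p : Prev P k × (GaugeField P k U1 × HiggsField P k) => ρ' p.1 p.2.1 p.2.2)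
    (hg : Measurable g) : Measurable (uIntegrand Qu Qφ a ρ' g) := by
  -- the full integrand on `(((u, {u^{(j)}}), φ), ψ)`-space
  have hsh : Measurable fun q : ((GaugeField P k U1 × Prev P k) × HiggsField P k) × HiggsField P (k+1) =>
      (q.1.1.2, (q.1.1.1, q.1.2)) :=
    (measurable_snd.comp (measurable_fst.comp measurable_fst)).prodMk
      ((measurable_fst.comp (measurable_fst.comp measurable_fst)).prodMk (measurable_snd.comp measurable_fst))
  have hρ3 : Measurable fun q : ((GaugeField P k U1 × Prev P k) × HiggsField P k) × HiggsField P (k+1) =>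
      ρ' q.1.1.2 q.1.1.1 q.1.2 := hρ.comp hsh
  have hG3 : Measurable fun q : ((GaugeField P k U1 × Prev P k) × HiggsField P k) × HiggsField P (k+1) =>
      (gaussWeight a (Qφ q.1.1.2 q.1.1.1 q.1.2) q.2 : ℂ) :=
    measurable_gaussWeight_comp a (hQφ.comp hsh) measurable_snd
  have hu3 : Measurable fun q : ((GaugeField P k U1 × Prev P k) × HiggsField P k) × HiggsField P (k+1) =>
      (Qu q.1.1.1, q.2) := (hQu.comp (measurable_fst.comp (measurable_fst.comp measurable_fst))).prodMk measurable_snd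
  have hg3 : Measurable fun q : ((GaugeField P k U1 × Prev P k) × HiggsField P k) × HiggsField P (k+1) =>
      g (Qu q.1.1.1, q.2) := hg.comp hu3
  have h3 : Measurable fun q : ((GaugeField P k U1 × Prev P k) × HiggsField P k) × HiggsField P (k+1) =>
      ρ' q.1.1.2 q.1.1.1 q.1.2 * (gaussWeight a (Qφ q.1.1.2 q.1.1.1 q.1.2) q.2 : ℂ) * g (Qu q.1.1.1, q.2) :=
    (hρ3.mul hG3).mul hg3
  -- integrate `ψ`, then `φ`, then `{u^{(j)}}`
  have h2 : StronglyMeasurable fun x : (GaugeField P k U1 × Prev P k) × HiggsField P k =>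
      ∫ ψ, ρ' x.1.2 x.1.1 x.2 * (gaussWeight a (Qφ x.1.2 x.1.1 x.2) ψ : ℂ) * g (Qu x.1.1, ψ) :=
    h3.stronglyMeasurable.integral_prod_right'
  have h1 : StronglyMeasurable fun x : GaugeField P k U1 × Prev P k =>
      ∫ φ, ∫ ψ, ρ' x.2 x.1 φ * (gaussWeight a (Qφ x.2 x.1 φ) ψ : ℂ) * g (Qu x.1, ψ) :=
    h2.integral_prod_right'
  exact (h1.integral_prod_right' (ν := prevMeasure P k)).measurable

/-- **The `u`-integrand of (5.1.1) is POINTED-invariant** — the printed argument of (5.1.4): under a gauge transformation `g` of `u`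
trivial at the block-lattice points, `δ(v/Qu)` is unchanged (`Qu` pointed-invariant: *"the δ-functions … are invariant"*), and after
the change of variables `φ ↦ gφ` (`𝒟φ` rotation invariant) and `{u^{(j)}} ↦ τ_g{u^{(j)}}` (`Π𝒟u^{(j)}` preserved — the transformation of
the earlier fields in (4.17)) the integrand is unchanged (*"ρ′_k [is] invariant. Since u_k also transforms by λ, we have Q(u_k)φ
invariant as well"*); the block field `ψ` is untouched. [cite: BalabanImbrieJaffe1988, (5.1.4) p.278] -/
theorem pointedInvariant_uIntegrand {Qu : GaugeField P k U1 → GaugeField P (k+1) U1}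
    {Qφ : Prev P k → GaugeField P k U1 → HiggsField P k → HiggsField P (k+1)} {a : ℝ}
    {ρ' : Prev P k → GaugeField P k U1 → HiggsField P k → ℂ}
    (hQu : ∀ g : GaugeTransf P k U1, IsPointed g → ∀ U, Qu (gaugeAct g U) = Qu U)
    (τ : GaugeTransf P k U1 → Prev P k ≃ᵐ Prev P k)
    (hτ : ∀ g : GaugeTransf P k U1, IsPointed g → MeasurePreserving (τ g) (prevMeasure P k) (prevMeasure P k))
    (hρ : ∀ g : GaugeTransf P k U1, IsPointed g → ∀ prev U φ, ρ' (τ g prev) (gaugeAct g U) (twist g φ) = ρ' prev U φ)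
    (hQφ : ∀ g : GaugeTransf P k U1, IsPointed g → ∀ prev U φ, Qφ (τ g prev) (gaugeAct g U) (twist g φ) = Qφ prev U φ)
    (gt : GaugeField P (k+1) U1 × HiggsField P (k+1) → ℂ) :
    PointedInvariant (uIntegrand Qu Qφ a ρ' gt) := by
  intro g hg U
  simp only [uIntegrand, hQu g hg U]
  calc ∫ prev, ∫ φ, ∫ ψ, ρ' prev (gaugeAct g U) φ * (gaussWeight a (Qφ prev (gaugeAct g U) φ) ψ : ℂ) * gt (Qu U, ψ)
          ∂volume ∂volume ∂prevMeasure P k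
      = ∫ prev, ∫ φ, ∫ ψ, ρ' (τ g prev) (gaugeAct g U) φ * (gaussWeight a (Qφ (τ g prev) (gaugeAct g U) φ) ψ : ℂ) *
          gt (Qu U, ψ) ∂volume ∂volume ∂prevMeasure P k :=
        ((hτ g hg).integral_comp' (fun prev => ∫ φ, ∫ ψ, ρ' prev (gaugeAct g U) φ *
          (gaussWeight a (Qφ prev (gaugeAct g U) φ) ψ : ℂ) * gt (Qu U, ψ) ∂volume ∂volume)).symm
    _ = ∫ prev, ∫ φ, ∫ ψ, ρ' (τ g prev) (gaugeAct g U) (twist g φ) *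
          (gaussWeight a (Qφ (τ g prev) (gaugeAct g U) (twist g φ)) ψ : ℂ) * gt (Qu U, ψ) ∂volume ∂volume ∂prevMeasure P k := by
        refine integral_congr_ae (Filter.Eventually.of_forall fun prev => ?_)
        exact (integral_comp_twist g (fun φ => ∫ ψ, ρ' (τ g prev) (gaugeAct g U) φ *
          (gaussWeight a (Qφ (τ g prev) (gaugeAct g U) φ) ψ : ℂ) * gt (Qu U, ψ) ∂volume)).symm
    _ = ∫ prev, ∫ φ, ∫ ψ, ρ' prev U φ * (gaussWeight a (Qφ prev U φ) ψ : ℂ) * gt (Qu U, ψ) ∂volume ∂volume ∂prevMeasure P k := by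
        simp only [hρ g hg, hQφ g hg]

/-- **(5.1.4) applied to the `u`-integral of (5.1.1)**: under the printed invariances (and joint measurability of the data), inserting
`δ_{Ax}(u)` into the `u`-integral of a term of (5.1.1) changes nothing — `∫𝒟u δ_{Ax}(u) I(u) = ∫𝒟u I(u)` for its `u`-integrand `I`
(standing range `k + 1 ≤ m + K`). [cite: BalabanImbrieJaffe1988, (5.1.4) p.278] -/
theorem integral_uIntegrand_axial_eq (hk : k + 1 ≤ P.m + P.K) {Qu : GaugeField P k U1 → GaugeField P (k+1) U1}
    {Qφ : Prev P k → GaugeField P k U1 → HiggsField P k → HiggsField P (k+1)} {a : ℝ}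
    {ρ' : Prev P k → GaugeField P k U1 → HiggsField P k → ℂ} {gt : GaugeField P (k+1) U1 × HiggsField P (k+1) → ℂ}
    (hQum : Measurable Qu)
    (hQφm : Measurable fun p : Prev P k × (GaugeField P k U1 × HiggsField P k) => Qφ p.1 p.2.1 p.2.2)
    (hρm : Measurable fun p : Prev P k × (GaugeField P k U1 × HiggsField P k) => ρ' p.1 p.2.1 p.2.2) (hgt : Measurable gt)
    (hQu : ∀ g : GaugeTransf P k U1, IsPointed g → ∀ U, Qu (gaugeAct g U) = Qu U)
    (τ : GaugeTransf P k U1 → Prev P k ≃ᵐ Prev P k)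
    (hτ : ∀ g : GaugeTransf P k U1, IsPointed g → MeasurePreserving (τ g) (prevMeasure P k) (prevMeasure P k))
    (hρ : ∀ g : GaugeTransf P k U1, IsPointed g → ∀ prev U φ, ρ' (τ g prev) (gaugeAct g U) (twist g φ) = ρ' prev U φ)
    (hQφ : ∀ g : GaugeTransf P k U1, IsPointed g → ∀ prev U φ, Qφ (τ g prev) (gaugeAct g U) (twist g φ) = Qφ prev U φ) :
    ∫ U, uIntegrand Qu Qφ a ρ' gt U ∂axialMeasure P k U1 = ∫ U, uIntegrand Qu Qφ a ρ' gt U ∂fieldMeasure P k U1 :=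
  integral_axialMeasure_eq_of_pointed hk (measurable_uIntegrand hQum hQφm hρm hgt)
    (pointedInvariant_uIntegrand hQu τ hτ hρ hQφ gt)

/-! ## §2 (5.1.4) for (5.1.1): `δ_{Ax}` is inserted at no cost; instances -/

/-- **(5.1.4) for (5.1.1)** p. 278 [PDF 22]: *"Thus no change is made if we insert the axial gauge conditions δ_{Ax}(u) … into the
u-integral above"* — PROVED: under the printed invariances — `Qu` pointed-invariant; for every term `t` and pointed `g` a
reparametrization `τ_t(g)` of the earlier fields preserving `Π𝒟u^{(j)}` (their transformation in (4.17); the identity for data ignoring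
them) with `ρ′_t(τ_t(g){u^{(j)}}, u^g, gφ) = ρ′_t({u^{(j)}}, u, φ)` and `Q_t(τ_t(g){u^{(j)}}, u^g, gφ) = Q_t({u^{(j)}}, u, φ)` — and joint
measurability of the data, a function `ρ̃(v, ψ)` satisfies the renormalization-transformation identity (5.1.1) if and only if it
satisfies it with `δ_{Ax}(u)` inserted: both define the same densities `ρ̃^L_{k+1}` (standing range `k + 1 ≤ m + K`).
[cite: BalabanImbrieJaffe1988, (5.1.4) p.278] -/
theorem isRT511_iff_isRT511Ax (hk : k + 1 ≤ P.m + P.K) {ι : Type*} {terms : Finset ι}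
    {Qu : GaugeField P k U1 → GaugeField P (k+1) U1} {Qφ : ι → Prev P k → GaugeField P k U1 → HiggsField P k → HiggsField P (k+1)}
    {a : ℝ} {ρ' : ι → Prev P k → GaugeField P k U1 → HiggsField P k → ℂ}
    (hQum : Measurable Qu)
    (hQφm : ∀ t ∈ terms, Measurable fun p : Prev P k × (GaugeField P k U1 × HiggsField P k) => Qφ t p.1 p.2.1 p.2.2)
    (hρm : ∀ t ∈ terms, Measurable fun p : Prev P k × (GaugeField P k U1 × HiggsField P k) => ρ' t p.1 p.2.1 p.2.2)
    (hQu : ∀ g : GaugeTransf P k U1, IsPointed g → ∀ U, Qu (gaugeAct g U) = Qu U)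
    (τ : ι → GaugeTransf P k U1 → Prev P k ≃ᵐ Prev P k)
    (hτ : ∀ t ∈ terms, ∀ g : GaugeTransf P k U1, IsPointed g → MeasurePreserving (τ t g) (prevMeasure P k) (prevMeasure P k))
    (hρ : ∀ t ∈ terms, ∀ g : GaugeTransf P k U1, IsPointed g → ∀ prev U φ,
      ρ' t (τ t g prev) (gaugeAct g U) (twist g φ) = ρ' t prev U φ)
    (hQφ : ∀ t ∈ terms, ∀ g : GaugeTransf P k U1, IsPointed g → ∀ prev U φ,
      Qφ t (τ t g prev) (gaugeAct g U) (twist g φ) = Qφ t prev U φ)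
    (ρL : GaugeField P (k+1) U1 → HiggsField P (k+1) → ℂ) :
    IsRT511 terms Qu Qφ a ρ' ρL ↔ IsRT511Ax terms Qu Qφ a ρ' ρL := by
  rw [isRT511_iff, isRT511Ax_iff]
  refine forall_congr' fun gt => forall_congr' fun hgt => forall_congr' fun _ => ?_
  have key : ∑ t ∈ terms, ∫ U, uIntegrand Qu (Qφ t) a (ρ' t) gt U ∂fieldMeasure P k U1 =
      ∑ t ∈ terms, ∫ U, uIntegrand Qu (Qφ t) a (ρ' t) gt U ∂axialMeasure P k U1 :=
    Finset.sum_congr rfl fun t ht =>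
      (integral_uIntegrand_axial_eq hk hQum (hQφm t ht) (hρm t ht) hgt hQu (τ t) (hτ t ht) (hρ t ht) (hQφ t ht)).symm
  rw [key]

/-! ### Instances: data ignoring the earlier fields (`τ = id`), and the PRINTED block averages of [2] -/

/-- **(5.1.4) for one term whose data ignore the earlier fields** (reparametrization `τ = id`): for a pointed-invariant measurable
`Qu`, a jointly pointed-invariant, jointly measurable scalar average `Q(u)φ` and density `ρ₀(u, φ)`, r18's (3.11) — printed WITH
`δ_{Ax}` — defines the same densities as the `δ_{Ax}`-free transformation (5.1.1) (one term, level `k` arbitrary).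
[cite: BalabanImbrieJaffe1988, (5.1.4) p.278] -/
theorem isRT311_iff_isRT511_single (hk : k + 1 ≤ P.m + P.K) {Qu : GaugeField P k U1 → GaugeField P (k+1) U1}
    {Qφ₀ : GaugeField P k U1 → HiggsField P k → HiggsField P (k+1)} {a : ℝ} {ρ₀ : GaugeField P k U1 → HiggsField P k → ℂ}
    (hQum : Measurable Qu) (hQφm : Measurable (uncurry Qφ₀)) (hρm : Measurable (uncurry ρ₀))
    (hQu : ∀ g : GaugeTransf P k U1, IsPointed g → ∀ U, Qu (gaugeAct g U) = Qu U)
    (hQφ : ∀ g : GaugeTransf P k U1, IsPointed g → ∀ U φ, Qφ₀ (gaugeAct g U) (twist g φ) = Qφ₀ U φ)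
    (hρ : ∀ g : GaugeTransf P k U1, IsPointed g → ∀ U φ, ρ₀ (gaugeAct g U) (twist g φ) = ρ₀ U φ)
    (ρL : GaugeField P (k+1) U1 → HiggsField P (k+1) → ℂ) :
    IsRT311 Qu Qφ₀ a ρ₀ ρL ↔ IsRT511 (Finset.univ : Finset Unit) Qu (fun _ _ => Qφ₀) a (fun _ _ => ρ₀) ρL := by
  rw [← isRT511Ax_single_iff_isRT311]
  exact (isRT511_iff_isRT511Ax hk hQum (fun _ _ => hQφm.comp measurable_snd) (fun _ _ => hρm.comp measurable_snd) hQu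
    (fun _ _ => MeasurableEquiv.refl (Prev P k)) (fun _ _ _ _ => MeasurePreserving.id _)
    (fun _ _ g hg _ U φ => hρ g hg U φ) (fun _ _ g hg _ U φ => hQφ g hg U φ) ρL).symm

/-- **The printed block average `Qu` ([2] (2.10)) is pointed-invariant**: by r18's gauge covariance `Q(u^h) = (Qu)^{h∘corner}`
(`BIJ85BlockAveragesTorus.qU_gaugeAct`), a gauge transformation trivial at the corners does not move `Qu` — *"the δ-functions … are
invariant"* for `δ(v/Qu)`. [cite: BalabanImbrieJaffe1988, (5.1.4) p.278] -/
theorem qU_pointed (hk : k + 1 ≤ P.m + P.K) {g : GaugeTransf P k U1} (hg : IsPointed g) (U : GaugeField P k U1) :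
    qU (gaugeAct g U) = qU U := by
  rw [qU_gaugeAct hk g U]
  have e : (fun y : Balaban1983to89.Site P (k+1) => g (corner y)) = fun _ => (1 : U1) := funext fun y => hg y
  rw [e, gaugeAct_const_one]

/-- **The printed scalar average `Q(u)φ` ([2] (2.6)) is jointly pointed-invariant**: `Q(u^g)(gφ)(y) = g(corner y)·(Q(u)φ)(y)` (r18's
`qCov_gaugeAct_twist`) and `g(corner y) = 1` — the `k = 0`, `u_k = u` case of *"Q(u_k)φ invariant as well"*.
[cite: BalabanImbrieJaffe1988, (5.1.4) p.278] -/
theorem qCov_pointed (hk : k + 1 ≤ P.m + P.K) {g : GaugeTransf P k U1} (hg : IsPointed g) (U : GaugeField P k U1)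
    (φ : HiggsField P k) : qCov (gaugeAct g U) (twist g φ) = qCov U φ := by
  funext y
  rw [qCov_gaugeAct_twist hk g U φ y, hg y, toC_one, one_mul]

/-- **(5.1.4) for the first-step transformation with the PRINTED block averages** `Qu` (2.10), `Q(u)φ` (2.6) of [2] on the torus of
record (r18's `BIJ85BlockAveragesTorus.qU`/`qCov`): for every jointly measurable density `ρ₀(u, φ)` that is jointly invariant under the
pointed gauge transformations, (3.11) with `δ_{Ax}(u)` and the same transformation without it define the same densities `ρ₁^L` —
every hypothesis of `isRT511_iff_isRT511Ax` discharged. [cite: BalabanImbrieJaffe1988, (5.1.4) p.278] -/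
theorem isRT311_printed_iff_free (hk : k + 1 ≤ P.m + P.K) {a : ℝ} {ρ₀ : GaugeField P k U1 → HiggsField P k → ℂ}
    (hρm : Measurable (uncurry ρ₀))
    (hρ : ∀ g : GaugeTransf P k U1, IsPointed g → ∀ U φ, ρ₀ (gaugeAct g U) (twist g φ) = ρ₀ U φ)
    (ρL : GaugeField P (k+1) U1 → HiggsField P (k+1) → ℂ) :
    IsRT311 qU qCov a ρ₀ ρL ↔ IsRT511 (Finset.univ : Finset Unit) qU (fun _ _ => qCov) a (fun _ _ => ρ₀) ρL :=
  isRT311_iff_isRT511_single hk BIJ85BlockAveragesTorus.measurable_qU BIJ85BlockAveragesTorus.measurable_qCov hρm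
    (fun _ hg U => qU_pointed hk hg U) (fun _ hg U φ => qCov_pointed hk hg U φ) hρ ρL

/-! ## §3 The reparametrization of the earlier fields in (4.17) as a measure-preserving equivalence -/

/-- The transformation of the earlier fields in (4.17) p. 277 — *"u_b^{(j)} → u_b^{(j)} exp[−ie_kL^jη(∂^{L^jη}Q′*_{k−j}λ)(b)], if
b ∈ Λ₁^{(j)*c}, u_b^{(j)} → u_b^{(j)}, otherwise"* — has the SHAPE "multiply every `u^{(j)}_b` by a fixed group element `w_j(b)`"
(`w_j(b) = 1` off `Λ₁^{(j)*c}`); as a measurable equivalence of the space of earlier fields (the reparametrization `τ(g)` of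
`isRT511_iff_isRT511Ax`, for the family `w` the transformation prescribes). [cite: BalabanImbrieJaffe1988, (4.17) p.277] -/
def mulRightPrev (w : (i : Fin k) → PBond P i → U1) : Prev P k ≃ᵐ Prev P k :=
  MeasurableEquiv.piCongrRight fun i => MeasurableEquiv.piCongrRight fun b => MeasurableEquiv.mulRight (w i b)

/-- kernel: `(mulRightPrev w){u^{(j)}} = {u^{(j)}_b w_j(b)}`. [cite: BalabanImbrieJaffe1988, (4.17) p.277] -/
theorem mulRightPrev_apply (w : (i : Fin k) → PBond P i → U1) (prev : Prev P k) (i : Fin k) (b : PBond P i) :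
    mulRightPrev w prev i b = prev i b * w i b := rfl

/-- **`Π𝒟u^{(j)}` is invariant under the transformation of the earlier fields in (4.17)** (right invariance of the normalized Haar
measures, bond by bond and level by level: `AveragingRT.measurePreserving_mulRight`) — so `τ(g) := mulRightPrev (w g)` discharges the
measure-preservation hypothesis of `isRT511_iff_isRT511Ax` for ANY prescription `w`. [cite: BalabanImbrieJaffe1988, (4.17) p.277] -/
theorem measurePreserving_mulRightPrev (w : (i : Fin k) → PBond P i → U1) :
    MeasurePreserving (mulRightPrev w) (prevMeasure P k) (prevMeasure P k) := by
  have h := measurePreserving_pi (fun i : Fin k => fieldMeasure P (i : ℕ) U1) (fun i : Fin k => fieldMeasure P (i : ℕ) U1)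
    (f := fun (i : Fin k) (u : GaugeField P (i : ℕ) U1) => fun b : PBond P i => u b * w i b)
    (fun i => AveragingRT.measurePreserving_mulRight (w i))
  have e : (⇑(mulRightPrev w) : Prev P k → Prev P k) =
      fun (a : Prev P k) (i : Fin k) => fun b : PBond P i => a i b * w i b := by
    funext a i b
    rfl
  unfold prevMeasure
  rw [e]
  exact h

/-- **(5.1.4) for (5.1.1) with the (4.17)-shaped reparametrization**: the same conclusion as `isRT511_iff_isRT511Ax` when, for every
term `t` and pointed `g`, the earlier fields are multiplied bondwise by prescribed group elements `w_t(g)` (measure preservation is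
then automatic, `measurePreserving_mulRightPrev`) and `ρ′_t`, `Q_t` are invariant under `({u^{(j)}}, u, φ) ↦ ({u^{(j)}w_t(g)}, u^g, gφ)`.
[cite: BalabanImbrieJaffe1988, (5.1.4) p.278] -/
theorem isRT511_iff_isRT511Ax_mulRight (hk : k + 1 ≤ P.m + P.K) {ι : Type*} {terms : Finset ι}
    {Qu : GaugeField P k U1 → GaugeField P (k+1) U1} {Qφ : ι → Prev P k → GaugeField P k U1 → HiggsField P k → HiggsField P (k+1)}
    {a : ℝ} {ρ' : ι → Prev P k → GaugeField P k U1 → HiggsField P k → ℂ}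
    (hQum : Measurable Qu)
    (hQφm : ∀ t ∈ terms, Measurable fun p : Prev P k × (GaugeField P k U1 × HiggsField P k) => Qφ t p.1 p.2.1 p.2.2)
    (hρm : ∀ t ∈ terms, Measurable fun p : Prev P k × (GaugeField P k U1 × HiggsField P k) => ρ' t p.1 p.2.1 p.2.2)
    (hQu : ∀ g : GaugeTransf P k U1, IsPointed g → ∀ U, Qu (gaugeAct g U) = Qu U)
    (w : ι → GaugeTransf P k U1 → (i : Fin k) → PBond P i → U1)
    (hρ : ∀ t ∈ terms, ∀ g : GaugeTransf P k U1, IsPointed g → ∀ prev U φ,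
      ρ' t (mulRightPrev (w t g) prev) (gaugeAct g U) (twist g φ) = ρ' t prev U φ)
    (hQφ : ∀ t ∈ terms, ∀ g : GaugeTransf P k U1, IsPointed g → ∀ prev U φ,
      Qφ t (mulRightPrev (w t g) prev) (gaugeAct g U) (twist g φ) = Qφ t prev U φ)
    (ρL : GaugeField P (k+1) U1 → HiggsField P (k+1) → ℂ) :
    IsRT511 terms Qu Qφ a ρ' ρL ↔ IsRT511Ax terms Qu Qφ a ρ' ρL :=
  isRT511_iff_isRT511Ax hk hQum hQφm hρm hQu (fun t g => mulRightPrev (w t g))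
    (fun t _ g _ => measurePreserving_mulRightPrev (w t g)) hρ hQφ ρL

/-! ## §4 The normalization of (5.1.1) through the inductive form (4.1): `∫dv dψ ρ̃^L_{k+1} = ∫𝒟u𝒟φ ρ_k = [F]` -/

/-- **Fubini for the `k`-step density**: if every term density `ρ′_t` is `𝒟u ⊗ Π𝒟u^{(j)} ⊗ 𝒟φ`-integrable, the `(u, φ)`-integral of
`ρ_k(u, φ) = Σ_t ∫Π𝒟u^{(j)} ρ′_t` ((4.1): the earlier fields integrated INSIDE) equals `Σ_t ∫𝒟u ∫Π𝒟u^{(j)} ∫𝒟φ ρ′_t` (the order of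
(5.1.1): the earlier fields integrated BEFORE `φ`). [cite: BalabanImbrieJaffe1988, (5.1.1) p.277] -/
theorem integral_rho_eq_sum {ι : Type*} {terms : Finset ι} {ρ' : ι → Prev P k → GaugeField P k U1 → HiggsField P k → ℂ}
    (hint : ∀ t ∈ terms, Integrable (fun q : GaugeField P k U1 × (Prev P k × HiggsField P k) => ρ' t q.2.1 q.1 q.2.2)
      ((fieldMeasure P k U1).prod ((prevMeasure P k).prod volume))) :
    ∫ U, ∫ φ, ∑ t ∈ terms, ∫ prev, ρ' t prev U φ ∂prevMeasure P k ∂volume ∂fieldMeasure P k U1 =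
      ∑ t ∈ terms, ∫ U, ∫ prev, ∫ φ, ρ' t prev U φ ∂volume ∂prevMeasure P k ∂fieldMeasure P k U1 := by
  -- a.e. in `u`, the `({u^{(j)}}, φ)`-section of every term is integrable
  have hsec : ∀ t ∈ terms, ∀ᵐ U ∂fieldMeasure P k U1,
      Integrable (fun p : Prev P k × HiggsField P k => ρ' t p.1 U p.2) ((prevMeasure P k).prod volume) :=
    fun t ht => (hint t ht).prod_right_ae
  have hall : ∀ᵐ U ∂fieldMeasure P k U1, ∀ t ∈ terms,
      Integrable (fun p : Prev P k × HiggsField P k => ρ' t p.1 U p.2) ((prevMeasure P k).prod volume) :=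
    (Finset.eventually_all terms).2 hsec
  -- (1) the finite sum leaves the `φ`-integral (a.e. in `u`)
  have h1 : (fun U => ∫ φ, ∑ t ∈ terms, ∫ prev, ρ' t prev U φ ∂prevMeasure P k ∂volume) =ᵐ[fieldMeasure P k U1]
      fun U => ∑ t ∈ terms, ∫ φ, ∫ prev, ρ' t prev U φ ∂prevMeasure P k ∂volume := by
    filter_upwards [hall] with U hU
    exact integral_finsetSum terms fun t ht => (hU t ht).integral_prod_right
  -- (2) for each term, a.e. in `u`: `∫𝒟φ ∫Π𝒟u^{(j)} = ∫Π𝒟u^{(j)} ∫𝒟φ` = the integral over the product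
  have h2 : ∀ t ∈ terms, (fun U => ∫ φ, ∫ prev, ρ' t prev U φ ∂prevMeasure P k ∂volume) =ᵐ[fieldMeasure P k U1]
      fun U => ∫ prev, ∫ φ, ρ' t prev U φ ∂volume ∂prevMeasure P k := fun t ht => by
    filter_upwards [hsec t ht] with U hU
    exact (integral_integral_swap (f := fun prev φ => ρ' t prev U φ) hU).symm
  have h3 : ∀ t ∈ terms, (fun U => ∫ p : Prev P k × HiggsField P k, ρ' t p.1 U p.2 ∂(prevMeasure P k).prod volume)
      =ᵐ[fieldMeasure P k U1] fun U => ∫ φ, ∫ prev, ρ' t prev U φ ∂prevMeasure P k ∂volume := fun t ht => by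
    filter_upwards [hsec t ht] with U hU
    rw [integral_prod _ hU]
    exact integral_integral_swap (f := fun prev φ => ρ' t prev U φ) hU
  -- (3) the summands are `𝒟u`-integrable, so the finite sum leaves the `u`-integral
  have hiU : ∀ t ∈ terms,
      Integrable (fun U => ∫ φ, ∫ prev, ρ' t prev U φ ∂prevMeasure P k ∂volume) (fieldMeasure P k U1) :=
    fun t ht => ((hint t ht).integral_prod_left).congr (h3 t ht)
  rw [integral_congr_ae h1, integral_finsetSum terms hiU]
  exact Finset.sum_congr rfl fun t ht => integral_congr_ae (h2 t ht)

/-- p. 274 [PDF 18] *"If we integrate this density over the u, φ variables, we obtain our original unnormalized expectation [F]"*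
carried through the general step: if the terms `ρ′_k(·, ·, {X_ω}, ·)` of the inductive form (4.1) represent `[F]` (r18's
`BIJ88InductiveForm41.Represents41`), are `𝒟u ⊗ Π𝒟u^{(j)} ⊗ 𝒟φ`-integrable, and `ρ̃` is obtained from them by the renormalization
transformation (5.1.1) (`IsRT511`, any `Qu`, any background kernels `Q(u_k)φ`, `a > 0`, `d ≥ 2`), then **`[F] = ∫dv dψ ρ̃^L_{k+1}(v, ψ)`**
— the normalization of the general step (`integral_eq_of_isRT511` and Fubini `integral_rho_eq_sum`). [cite: BalabanImbrieJaffe1988, (5.1.1) p.277] -/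
theorem bracket_eq_integral_of_isRT511 {ι : Type*} (hd : 2 ≤ P.d) {a : ℝ} (ha : 0 < a) {terms : Finset ι}
    {T : ι → BIJ88InductiveForm41.Term41 P k}
    {S : GaugeField P 0 U1 → (Balaban1983to89.Site P 0 → ℂ) → ℝ} {F : GaugeField P 0 U1 → (Balaban1983to89.Site P 0 → ℂ) → ℂ}
    (h41 : BIJ88InductiveForm41.Represents41 terms T S F)
    {Qu : GaugeField P k U1 → GaugeField P (k+1) U1} {Qφ : ι → Prev P k → GaugeField P k U1 → HiggsField P k → HiggsField P (k+1)}
    {ρL : GaugeField P (k+1) U1 → HiggsField P (k+1) → ℂ}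
    (h : IsRT511 terms Qu Qφ a (fun t prev U φ => BIJ88InductiveForm41.rhoPrime (T t) prev (cfg U) φ) ρL)
    (hint : ∀ t ∈ terms, Integrable
      (fun q : GaugeField P k U1 × (Prev P k × HiggsField P k) => BIJ88InductiveForm41.rhoPrime (T t) q.2.1 (cfg q.1) q.2.2)
      ((fieldMeasure P k U1).prod ((prevMeasure P k).prod volume))) :
    bracket S F = ∫ v, ∫ ψ, ρL v ψ ∂volume ∂fieldMeasure P (k+1) U1 := by
  rw [← h41, integral_eq_of_isRT511 hd ha h]
  exact integral_rho_eq_sum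
    (ρ' := fun t prev U φ => BIJ88InductiveForm41.rhoPrime (T t) prev (cfg U) φ) hint

end NoChange

end

end Literature.MathematicalPhysics.QuantumFieldTheory.BalabanImbrieJaffe1984to88.BIJ88RT51NoChange
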